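import Summits.KontsevichZagierPeriods.KontsevichZagierPeriods.Theses.HurwitzMicroSectors
import Summits.KontsevichZagierPeriods.KontsevichZagierPeriods.Theorems.HurwitzMicroSectorsNormalFormPrinciplePiBoxTransfer
import Summits.KontsevichZagierPeriods.KontsevichZagierPeriods.Theorems.HurwitzMicroSectorsNormalFormPrincipleVariants2204
import Summits.KontsevichZagierPeriods.KontsevichZagierPeriods.Theorems.HurwitzMicroSectorsNormalFormPrincipleVariants2238

/-! TTRL-lite variant V2228 of stmt-KontsevichZagierPeriods-3869

Variant V2228 = `stub_boxRigidity` (the leaf `BoxRigidity` of `NormalFormPrinciple`: two representations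
on open unit boxes with integrands of KZ's rational shape `p/q`, `p, q` over `ℚ`, and equal values are
KZ-equivalent) under the TWO-sided small-case move `fix_nat:m=2; bound_nat:m'≤6` (left dimension
frozen to `2`, right dimension `≤ 6`). Verdict of the attempt seat: **open** — this file is the
exact-strength certificate, not a proof of the variant. As for every two-sided sibling
(`…Variants2204/2238/2239/2340/2349/2350`), the strength of a joint bound is that of its LARGEST
dimension, here `6`:
* `stub_boxRigidity_var2228_iff_boxVanishing_six`: V2228 ⟺ **BoxVanishing 6** — every box-rational
  representation on `(0,1)⁶` of value `0` is a relation (⇒: the pair `(2, 6)` is allowed, compare with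
  the zero representation on the square, `boxVanishingDim_right_of_pair`; ⇐: pad both sides to the
  `6`-box and subtract there, `boxRigidityLe_of_boxVanishingDim`, both from `…Variants2238`);
* `stub_boxRigidity_var2228_iff_le_six`: V2228 ⟺ BoxRigidity with BOTH dimensions `≤ 6` (freezing
  `m = 2` rather than bounding it loses nothing);
* `stub_boxRigidity_var2204_of_var2228`, `catalanSector_unconditional_of_stub_boxRigidity_var2228`:
  V2228 contains V2204 (= BoxVanishing 2) and hence Conjecture 1 on the level-`4` (Catalan) sector of
  the square with NO independence input — a rung the route closes only under the open hypothesis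
  `Indep_ℚ(1, π², G)`; BoxVanishing 6 moreover decides every `ℚ`-linear relation among the
  absolutely convergent `∫_{(0,1)^j} p/q`, `j ≤ 6` (`ζ(3)`, `ζ(5)`, `π³`, `πζ(3)`, `Li_k` at rationals,
  …) in favour of the four moves — nothing in the tree or in print proves that;
* `stub_boxRigidity_var2228_of_statement` / `_of_parent`: Summit ⇒ parent ⇒ V2228, so a refutation of
  the variant would refute Conjecture 1 for the tree's calculus.
Source: M. Kontsevich, D. Zagier, *Periods* (2001), §1.2 Conjecture 1. Pure proof file, no definitions. -/

-- `Summit.<Summit>.<Problem>` is the tree's mandated summit-side namespace (CONVENTIONS §2); for this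
-- single-conjunct summit the two coincide, so the duplicate is deliberate.
set_option linter.dupNamespace false

noncomputable section

namespace Summit.KontsevichZagierPeriods.KontsevichZagierPeriods.Theorems

open MeasureTheory Set
open Literature.NumberTheory.Transcendental Literature.NumberTheory.Transcendental.KZ
open Summit.KontsevichZagierPeriods.KontsevichZagierPeriods.Theses.HurwitzMicroSectors
open Summit.KontsevichZagierPeriods.HurwitzMicroSectors.NormalFormPrinciple.PiBox

/-! ## The variant V2228: Conjecture 1 for box-rational periods of dimension `6` -/

/-- **V2228 ⟺ BoxVanishing in dimension `6`** (every box-rational representation on `(0,1)⁶` of value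
`0` is a relation): (⇒) the pair of dimensions `(2, 6)` is allowed, so compare a vanishing box-rational
representation on `(0,1)⁶` with the zero representation on the square (`boxVanishingDim_right_of_pair`);
(⇐) pad both representations to the `6`-box and subtract there (`boxRigidityLe_of_boxVanishingDim 6`
with `m = 2 ≤ 6`, `m' ≤ 6`). [cite: KontsevichZagier2001, §1.2 Conjecture 1] -/
theorem stub_boxRigidity_var2228_iff_boxVanishing_six :
    (∀ (m' : ℕ) (N : IntegralRep 2) (N' : IntegralRep m'), m' ≤ 6 → N.domain = {x | ∀ i, x i ∈ Set.Ioo (0:ℝ) 1} → N.IsRational → N'.domain = {x | ∀ i, x i ∈ Set.Ioo (0:ℝ) 1} → N'.IsRational → N.value = N'.value → Equivalent N N') ↔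
    (∀ (M : IntegralRep 6), M.domain = {x | ∀ i, x i ∈ Set.Ioo (0:ℝ) 1} → M.IsRational →
      M.value = 0 → of M ∈ relations) :=
  ⟨fun h => boxVanishingDim_right_of_pair 2 6 fun N N' => h 6 N N' le_rfl,
    fun hvan m' N N' hm' => boxRigidityLe_of_boxVanishingDim 6 hvan 2 m' N N' (by norm_num) hm'⟩

/-- **V2228 ⟺ BoxRigidity for all dimensions `m, m' ≤ 6`** (so V2228 coincides with every two-sided
sibling of maximum dimension `6`: `bound_nat:m≤6; bound_nat:m'≤6`, `fix_nat:m'=6; bound_nat:m≤k`, …).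
[cite: KontsevichZagier2001, §1.2 Conjecture 1] -/
theorem stub_boxRigidity_var2228_iff_le_six :
    (∀ (m' : ℕ) (N : IntegralRep 2) (N' : IntegralRep m'), m' ≤ 6 → N.domain = {x | ∀ i, x i ∈ Set.Ioo (0:ℝ) 1} → N.IsRational → N'.domain = {x | ∀ i, x i ∈ Set.Ioo (0:ℝ) 1} → N'.IsRational → N.value = N'.value → Equivalent N N') ↔
    (∀ (m m' : ℕ) (N : IntegralRep m) (N' : IntegralRep m'), m ≤ 6 → m' ≤ 6 →
      N.domain = {x | ∀ i, x i ∈ Set.Ioo (0:ℝ) 1} → N.IsRational →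
      N'.domain = {x | ∀ i, x i ∈ Set.Ioo (0:ℝ) 1} → N'.IsRational →
      N.value = N'.value → Equivalent N N') := by
  rw [stub_boxRigidity_var2228_iff_boxVanishing_six]
  exact ⟨fun hvan => boxRigidityLe_of_boxVanishingDim 6 hvan,
    fun h => boxVanishingDim_left_of_pair 6 6 fun N N' => h 6 6 N N' le_rfl le_rfl⟩

/-- **V2228 ⇒ BoxVanishing in every dimension `j ≤ 6`** (monotonicity in the dimension, by padding):
in particular the dimension-`3` statement (`ζ(3)`, `π³`, `Li₃` values, …) and the dimension-`2` one.
[cite: KontsevichZagier2001, §1.2 Conjecture 1] -/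
theorem boxVanishing_le_six_of_stub_boxRigidity_var2228
    (h : ∀ (m' : ℕ) (N : IntegralRep 2) (N' : IntegralRep m'), m' ≤ 6 → N.domain = {x | ∀ i, x i ∈ Set.Ioo (0:ℝ) 1} → N.IsRational → N'.domain = {x | ∀ i, x i ∈ Set.Ioo (0:ℝ) 1} → N'.IsRational → N.value = N'.value → Equivalent N N')
    {j : ℕ} (hj : j ≤ 6) (N : IntegralRep j) (hNd : N.domain = {x | ∀ i, x i ∈ Set.Ioo (0:ℝ) 1})
    (hNr : N.IsRational) (hv : N.value = 0) : of N ∈ relations :=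
  boxVanishingDim_mono hj (stub_boxRigidity_var2228_iff_boxVanishing_six.1 h) N hNd hNr hv

/-- **V2228 ⇒ V2204** (`fix_nat:m=2; bound_nat:m'≤2`, i.e. BoxVanishing 2): restrict the right
dimension from `≤ 6` to `≤ 2`. [cite: KontsevichZagier2001, §1.2 Conjecture 1] -/
theorem stub_boxRigidity_var2204_of_var2228
    (h : ∀ (m' : ℕ) (N : IntegralRep 2) (N' : IntegralRep m'), m' ≤ 6 → N.domain = {x | ∀ i, x i ∈ Set.Ioo (0:ℝ) 1} → N.IsRational → N'.domain = {x | ∀ i, x i ∈ Set.Ioo (0:ℝ) 1} → N'.IsRational → N.value = N'.value → Equivalent N N') :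
    ∀ (m' : ℕ) (N : IntegralRep 2) (N' : IntegralRep m'), m' ≤ 2 → N.domain = {x | ∀ i, x i ∈ Set.Ioo (0:ℝ) 1} → N.IsRational → N'.domain = {x | ∀ i, x i ∈ Set.Ioo (0:ℝ) 1} → N'.IsRational → N.value = N'.value → Equivalent N N' :=
  fun m' N N' hm' => h m' N N' (hm'.trans (by norm_num))

/-- **V2228 ⇒ the Catalan rung unconditionally**: the CONCLUSION of the route item
`CatalanSectorTwoFour` (two representations on `(0,1)²` with integrands `P(xy)/(1 − (xy)⁴)` and equal
values are KZ-equivalent) without its open hypothesis `Indep_ℚ(1, π², G)` — via V2204.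
[cite: KontsevichZagier2001, §1.2 Conjecture 1] -/
theorem catalanSector_unconditional_of_stub_boxRigidity_var2228
    (h : ∀ (m' : ℕ) (N : IntegralRep 2) (N' : IntegralRep m'), m' ≤ 6 → N.domain = {x | ∀ i, x i ∈ Set.Ioo (0:ℝ) 1} → N.IsRational → N'.domain = {x | ∀ i, x i ∈ Set.Ioo (0:ℝ) 1} → N'.IsRational → N.value = N'.value → Equivalent N N') :
    ∀ (r r' : IntegralRep 2) (P P' : Polynomial ℚ), r.domain = {x | ∀ i, x i ∈ Set.Ioo (0:ℝ) 1} →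
      r'.domain = {x | ∀ i, x i ∈ Set.Ioo (0:ℝ) 1} →
      EqOn r.integrand (fun x => Polynomial.aeval (x 0 * x 1) P / (1 - (x 0 * x 1) ^ 4)) r.domain →
      EqOn r'.integrand (fun x => Polynomial.aeval (x 0 * x 1) P' / (1 - (x 0 * x 1) ^ 4)) r'.domain →
      r.value = r'.value → Equivalent r r' :=
  catalanSector_unconditional_of_stub_boxRigidity_var2204 (stub_boxRigidity_var2204_of_var2228 h)

/-- **The parent leaf ⇒ V2228** (the variant is a specialisation of `stub_boxRigidity`; the converse is
not claimed — the parent is BoxVanishing in ALL dimensions). [cite: KontsevichZagier2001, §1.2 Conjecture 1] -/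
theorem stub_boxRigidity_var2228_of_parent
    (h : ∀ (m m' : ℕ) (N : IntegralRep m) (N' : IntegralRep m'), N.domain = {x | ∀ i, x i ∈ Set.Ioo (0:ℝ) 1} → N.IsRational → N'.domain = {x | ∀ i, x i ∈ Set.Ioo (0:ℝ) 1} → N'.IsRational → N.value = N'.value → Equivalent N N') :
    ∀ (m' : ℕ) (N : IntegralRep 2) (N' : IntegralRep m'), m' ≤ 6 → N.domain = {x | ∀ i, x i ∈ Set.Ioo (0:ℝ) 1} → N.IsRational → N'.domain = {x | ∀ i, x i ∈ Set.Ioo (0:ℝ) 1} → N'.IsRational → N.value = N'.value → Equivalent N N' :=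
  fun m' N N' _ => h 2 m' N N'

/-- **`KontsevichZagierPeriods ⇒ V2228`**: the variant is a special case of Conjecture 1 for the
tree's calculus (`leaves_of_statement`) — so a refutation of the variant would refute the Summit.
[cite: KontsevichZagier2001, §1.2 Conjecture 1] -/
theorem stub_boxRigidity_var2228_of_statement (h : _root_.KontsevichZagierPeriods) :
    ∀ (m' : ℕ) (N : IntegralRep 2) (N' : IntegralRep m'), m' ≤ 6 → N.domain = {x | ∀ i, x i ∈ Set.Ioo (0:ℝ) 1} → N.IsRational → N'.domain = {x | ∀ i, x i ∈ Set.Ioo (0:ℝ) 1} → N'.IsRational → N.value = N'.value → Equivalent N N' :=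
  stub_boxRigidity_var2228_of_parent (leaves_of_statement h).1

end Summit.KontsevichZagierPeriods.KontsevichZagierPeriods.Theorems

end
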